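import Summits.AtomisticToContinuum.HydrodynamicLimit.Theorems.InformationPercolationEngineChaosClosesEulerEnskogTensor
import Summits.AtomisticToContinuum.HydrodynamicLimit.Theorems.CollisionIsometryCLTCollisionalTransferLocalityAffineSlaving
import Literature.MathematicalPhysics.KineticTheory.EvenCollisionTubeFunctional
import Literature.MathematicalPhysics.KineticTheory.Hilbert6Wave0
import HarnessLib

/-!
# [SPH]: the sphere-integrated momentum-transfer mark is half a quadratic flux moment
(line `hemisphere-affine-slaving`, crux `CollisionalTransferLocality`, stmt-AtomisticToContinuum-9518)

Helper file (`--supports stmt-AtomisticToContinuum-9518`; registered stub `stub_sphereMark_evenMark_eq_half`)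
of the line lead.  For the J-even collisional momentum-transfer mark `Ξ_P^{ab}(ω, v, w) = ((w − v)·ω)₊ ω_a ω_b`
(`evenMark`) and its sphere-integrated form `Θ Ξ v w = ∫_{S²} Ξ(ω, v, w) ((w − v)·ω)₊ dσ(ω)` (`sphereMark`,
`σ = volume.toSphere = sphereMeasure`, mass `4π`):

  `Θ(Ξ_P^{ab})(v, w) = ∫_{S²} ((w − v)·ω)₊² ω_a ω_b dσ = ½ ∫_{S²} ((v − w)·ω)² ω_a ω_b dσ`.

Both sides are evaluated in closed form by LANDED identities — no antipodal-symmetry argument: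
* left: `∫ (g·ω)₊² ω_a ω_b dσ = (2π/15)(‖g‖² δ_ab + 2 g_a g_b)` with `g = w − v`
  (`ChaosClosesEulerEnskogTensor.stub_enskogTensorIdentity`, Chapman–Cowling 1970 §16.4);
* right: `∫ (g·ω)² ω_a ω_b dσ = (4π/15)(‖g‖² δ_ab + 2 g_a g_b)` with `g = v − w`
  (`integral_sphere_inner_sq_mul` of `…AffineSlaving` with `V = e = 0` and the matrix unit `G = E_{ab}`);
and `‖v − w‖ = ‖w − v‖`, `(v − w)_a (v − w)_b = (w − v)_a (w − v)_b`.
References: S. Chapman, T. G. Cowling, *The Mathematical Theory of Non-Uniform Gases*, 3rd ed. (1970), §16.4.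
-/

namespace Summit.AtomisticToContinuum.HydrodynamicLimit.Theorems.HemisphereAffineSlaving

open scoped BigOperators Topology Classical ENNReal InnerProductSpace
open Filter Set Function MeasureTheory

noncomputable section

open Literature.MathematicalPhysics.KineticTheory (T3 V3)

/-- Contraction against the matrix unit `E_{ab}`: `Σ_c Σ_d f c d [a = c][b = d] = f a b`. [folklore] -/
theorem sum_sum_mul_matrixUnit (f : Fin 3 → Fin 3 → ℝ) (a b : Fin 3) :
    ∑ c, ∑ d, f c d * (if a = c ∧ b = d then 1 else 0) = f a b := by
  have h : ∀ c d, f c d * (if a = c ∧ b = d then (1 : ℝ) else 0) =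
      if b = d then (if a = c then f c d else 0) else 0 := by
    intro c d
    split_ifs with h1 h2 h3 <;> simp_all
  simp only [h, Finset.sum_ite_eq, Finset.mem_univ, if_true]

/-- **The quadratic flux moment in closed form**: `∫_{S²} ⟪g, ω⟫² ω_a ω_b dσ = (4π/15)(‖g‖² δ_ab + 2 g_a g_b)`
for `σ = volume.toSphere` (from `integral_sphere_inner_sq_mul` with `V = e = 0`, `G = E_{ab}`). [folklore] -/
theorem integral_sphere_inner_sq_mul_coord (g : V3) (a b : Fin 3) :
    ∫ ω : Metric.sphere (0 : V3) 1, inner ℝ g (ω : V3) ^ 2 * ((ω : V3) a * (ω : V3) b)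
        ∂((volume : Measure V3).toSphere) =
      4 * Real.pi / 15 * (‖g‖ ^ 2 * (if a = b then 1 else 0) + 2 * (g a * g b)) := by
  have h := integral_sphere_inner_sq_mul g 0 0 (fun c d => if a = c ∧ b = d then 1 else 0)
  simp only [inner_zero_left, inner_zero_right, zero_mul, add_zero, mul_zero,
    sum_sum_mul_matrixUnit] at h
  rw [h]
  congr 1
  have hdiag : ∑ c : Fin 3, (if a = c ∧ b = c then (1 : ℝ) else 0) = if a = b then 1 else 0 := by
    have : ∀ c : Fin 3, (if a = c ∧ b = c then (1 : ℝ) else 0) = if a = c then (if a = b then 1 else 0) else 0 := by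
      intro c
      split_ifs with h1 h2 h3 <;> simp_all
    simp only [this, Finset.sum_ite_eq, Finset.mem_univ, if_true]
  rw [hdiag]

/-- **The sphere-integrated even mark in closed form**:
`Θ(Ξ_P^{ab})(v, w) = (2π/15)(‖w − v‖² δ_ab + 2 (w − v)_a (w − v)_b)` (`stub_enskogTensorIdentity` with
`g = w − v`: the integrand is `((w − v)·ω)₊² ω_a ω_b`). [cite: ChapmanCowling1970, §16.4] -/
theorem sphereMark_evenMark_eq (a b : Fin 3) (v w : V3) :
    Literature.MathematicalPhysics.KineticTheory.sphereMark
        (Literature.MathematicalPhysics.KineticTheory.evenMark a b) v w =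
      2 * Real.pi / 15 * (‖w - v‖ ^ 2 * (if a = b then 1 else 0) + 2 * ((w - v) a * (w - v) b)) := by
  rw [← ChaosClosesEulerEnskogTensor.stub_enskogTensorIdentity (w - v) a b]
  unfold Literature.MathematicalPhysics.KineticTheory.sphereMark
    Literature.MathematicalPhysics.KineticTheory.evenMark
  refine integral_congr_ae (Eventually.of_forall fun ω => ?_)
  simp only [Literature.MathematicalPhysics.KineticTheory.hardSphereKernel]
  ring

/-- REGISTERED STUB `stub_sphereMark_evenMark_eq_half` ([SPH]) of the line `hemisphere-affine-slaving`:
`Θ(Ξ_P^{ab})(v, w) = ½ ∫_{S²} ⟪v − w, ω⟫² ω_a ω_b dσ(ω)`, `σ = volume.toSphere` — both sides in closed form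
(`sphereMark_evenMark_eq`, `integral_sphere_inner_sq_mul_coord`), `‖v − w‖ = ‖w − v‖`,
`(v − w)_a (v − w)_b = (w − v)_a (w − v)_b`. [cite: ChapmanCowling1970, §16.4] -/
theorem stub_sphereMark_evenMark_eq_half : ∀ (a b : Fin 3) (v w : V3), Literature.MathematicalPhysics.KineticTheory.sphereMark (Literature.MathematicalPhysics.KineticTheory.evenMark a b) v w = 1 / 2 * ∫ ω : Metric.sphere (0 : V3) 1, inner ℝ (v - w) (ω : V3) ^ 2 * ((ω : V3) a * (ω : V3) b) ∂((volume : Measure V3).toSphere) := by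
  intro a b v w
  rw [sphereMark_evenMark_eq, integral_sphere_inner_sq_mul_coord, norm_sub_rev v w]
  have hab : (v - w) a * (v - w) b = (w - v) a * (w - v) b := by
    rw [← neg_sub w v, WithLp.ofLp_neg, Pi.neg_apply, Pi.neg_apply, neg_mul_neg]
  rw [hab]
  ring

end

end Summit.AtomisticToContinuum.HydrodynamicLimit.Theorems.HemisphereAffineSlaving
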